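import Mathlib
import Mathlib.NumberTheory.ArithmeticFunction.Liouville
import Literature.Barriers.Parity.SiegelZeroPrimePairs
import Literature.NumberTheory.Sieve.SingularSeriesProofs
import Literature.NumberTheory.Sieve.LinearEquationsInPrimesWTrick
import Literature.NumberTheory.Sieve.ParityBarrier
import Literature.NumberTheory.Sieve.ParityWave0
import Literature.NumberTheory.LFunctions.RHWave0
import HarnessLib.Audit
import Literature.Barriers.Parity.SiegelZeroDichotomy
import HarnessLib

/-!
# UnboundedSiegelZeros — CONJECTURE (obligation of Parity/GeneralizedHardyLittlewood)

Unproven conjecture migrated by the gate from `Literature/Barriers/Parity/SiegelZeroDichotomy.lean` (`Literature.Barriers.Parity.UnboundedSiegelZeros`): unproven conjectures are obligations of our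
theories, not literature facts (human ruling 2026-08-15). Provenance: TaoTeravainen2021. Routes use it as a crux item or via
`--conditional-bridge --conditional-on UnboundedSiegelZeros`; a proof goes in the sibling `Theorems/UnboundedSiegelZerosHolds.lean` as `theorem UnboundedSiegelZeros_holds : UnboundedSiegelZeros` so this file stays a conjecture LEAF that Literature/ may import.
-/

namespace Summit.Parity.GeneralizedHardyLittlewood

open Literature Literature.Barriers Literature.Barriers.Parity
open Filter Finset
open scoped ArithmeticFunction.vonMangoldt Topology

/-- OPEN CONJECTURE — **Siegel zeros of unbounded quality exist** (the standing HYPOTHESIS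
"Siegel zeros exist" of Heath-Brown's dichotomy, in the form supported by Theorem 1.5 (i)): for
every `η₀` and `q₀` there is a Siegel zero (Definition 1.4: `χ` primitive quadratic mod `q`,
`L(1 - 1/(η log q), χ) = 0`, quality `η ≥ 10`) of quality `η ≥ η₀` attached to a conductor
`q ≥ q₀`. POSED — as a hypothesis to argue under, never as a result — in T. Tao, J. Teräväinen,
*The Hardy–Littlewood–Chowla conjecture in the presence of a Siegel zero*, J. London Math. Soc.
(2) 106 (2022), arXiv:2109.06291: Abstract "Assuming that Siegel zeros exist, we prove a hybrid
version of the Chowla and Hardy–Littlewood prime tuples conjectures"; §1.1 (the paragraph before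
Definition 1.4) "it turns out (perhaps surprisingly) that some progress on this conjecture can be
made under an opposing hypothesis, namely the existence of a Siegel zero"; Theorem 1.5 "Suppose
that one has a Siegel zero `β` with associated conductor `q_χ` and quality `η`", whose part (i) is
Heath-Brown's *Prime twins and Siegel zeros* (1983) "[11, Theorem 1]" with error term
`O(1/log log η)` — informative only as `η → ∞`, i.e. for zeros of UNBOUNDED quality at
arbitrarily large conductors, which is the statement below
[cite: TaoTeravainen2021, Abstract, §1.1 (before Definition 1.4), Definition 1.4 and Theorem 1.5 (i)].
Standing: proved nowhere and expected to be FALSE — it is the negation of a consequence of the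
Generalised Riemann Hypothesis (companion file `SiegelZeroDichotomyProofs.lean`,
`not_unboundedSiegelZeros_of_generalizedRiemannHypothesis`; the rh.S34 version
`not_unboundedSiegelZeros_of_noSiegelZeros` is proved below), while its negation — a bound
`η < η₀` on the quality of every Siegel zero at conductors `q ≥ q₀`, an effective Siegel-type
zero-free interval (`not_unboundedSiegelZeros_iff`, `not_unboundedSiegelZeros_iff_zeroFree` in the
companion file) — is open as well: "From Siegel's theorem we have the (ineffective) upper bound
`η ≪_ε q_χ^ε` on the quality of a Siegel zero for any `ε > 0`" is all that is printed
[cite: TaoTeravainen2021, (1.4)]. A registered OPEN statement (CONVENTIONS §4), not literature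
debt: there is deliberately no `UnboundedSiegelZeros_holds`; the statement is used only as the
antecedent of the record `SiegelZeroTwinPrimes := UnboundedSiegelZeros → TwinPrimeConjecture` and,
negated, as the conclusion of the no-go theorems. The name is kept (not `…Conjecture`) because
`SiegelZeroTwinPrimes`, `SiegelZeroDichotomyProofs.lean`, `SiegelZeroDichotomyHolds.lean` and
several Theses docstrings and idea cards of the summit `Parity` refer to it. [status: open] -/
@[conjecture] def UnboundedSiegelZeros : Prop :=
  ∀ (η₀ : ℝ) (q₀ : ℕ), ∃ (q : ℕ) (_ : NeZero q) (χ : DirichletCharacter ℂ q) (η : ℝ),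
    q₀ ≤ q ∧ η₀ ≤ η ∧ IsSiegelZero χ η

end Summit.Parity.GeneralizedHardyLittlewood
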